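/-
Copyright (c) 2026 the pub-hodgecm-mathlib formalisation cell (harness21).  Prover seat hodgecm-mathlib-K2Liu-p14 (g0): Track B «K2-LIT»,
hLiu418 = stmt-HodgeConjecture-24832; LEAD F0P6-plan (g13) RULING M-157b 2026-09-04T08:37:16Z «G5 (β) GODEMENT SECTIONS EXHAUST», file (β3).
-/
import Summits.HodgeConjecture.HodgeConjecture.Theorems.F0P2wPartialDedekindZetaPole   -- ★ `hasProd_partialDedekindZeta`, `differentiableOn_partialDedekindZeta`, `norm_residueCard_cpow_neg_le`
import HarnessLib

/-!
# Crux `HLiu418`, road `K2_Liu`, Road Φ organ G5 (β) «Godement sections exhaust», file (β3):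
# THE INVERSE PARTIAL EULER PRODUCT `w ↦ ζ_K^S(w)⁻¹ = Π_{v∉S} (1 − q_v^{−w})` IS HOLOMORPHIC AND LOCALLY BOUNDED ON `{1 < re w}`

Cell `hodgecm-mathlib`, crux item hLiu418 = `stmt-HodgeConjecture-24832`; squad K2 ∕ K2Liu; prover K2Liu-p14 (g0).
THEOREMS ONLY (no `def`, no instance, no notation, no named-fact hypothesis, no `sorry`); lane `--supports stmt-HodgeConjecture-24832`
(count-neutral helper).  `K` any number field, `S` any set of finite places, `ζ_K^S(w) = ★ partialStandardL S (fun _ ↦ {1}) w`.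

THE ROLE OF THIS FILE (RULING M-157b (β3)∕(β4)).  In the Godement presentation of a flat `K`-finite section of the inner `GL₂(𝔸_L)` series, the
places `v ∉ S` carry the spherical datum `𝟙_{𝒪_v²}` whose local Godement coefficient is `vol_v · ζ_v(2s)` (β2); the GLOBAL coefficient in front of the
mirabolic Eisenstein series is therefore `[vol · ζ_L^S(2λ + 1)]⁻¹ × (arch)⁻¹` at `s = λ + ½`, and ★ (γ) `exists_middle_package` (K2Liu-p10 (g2)) wants it
`DifferentiableOn ℂ … {0 < re λ}` (`had`) and bounded near every `z` with `0 < re z` (`hag`).  This file supplies exactly that for the `ζ`-part: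
* §1 `hasProd_one_sub_residueCard_cpow` — `HasProd (v ∉ S ↦ 1 − q_v^{−w}) (ζ_K^S(w))⁻¹` on `1 < re w` (★ `hasProd_partialDedekindZeta` inverted through
  `Tendsto.inv₀`; the inverse is ITSELF an absolutely convergent product of ENTIRE factors — no non-vanishing theorem is used);
* §2 `norm_inv_partialDedekindZeta_le_exp` — `‖ζ_K^S(w)⁻¹‖ ≤ exp(Σ_{v∉S} q_v^{−σ₁})` for `1 < σ₁ ≤ re w` (★ `HolomorphicProducts.norm_tprod_le_exp_tsum`);
* §3 `differentiableOn_inv_partialDedekindZeta` — `w ↦ ζ_K^S(w)⁻¹` holomorphic on `{1 < re w}`;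
* §4 the affine pullback `λ ↦ ζ_K^S(2λ + 1)⁻¹` on `{0 < re λ}`: holomorphic (`had` shape) and bounded on the disc `dist λ z < re z ∕ 2` (`hag` shape, exponent `A = 0`).
HONEST LABEL.  `HC_CM` is proved only modulo the 7 printed citations (2 remaining named inputs: hLiu418 = `stmt-HodgeConjecture-24832`,
h413 = `stmt-HodgeConjecture-24833`) until rung 0 closes.

## References
* [NeukirchANT1999] J. Neukirch, *Algebraic Number Theory* (1999), Ch. VII (5.2) (absolute convergence of the Euler product of `ζ_K` on `re > 1`).
* [Conway1978] J. B. Conway, *Functions of One Complex Variable* (1978), VII.5 Lemma 5.8, Thm. 5.9 (holomorphic infinite products, the bound `exp Σ b_i`).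
* [CogdellAnalyticTheory2004] J. W. Cogdell, *Analytic theory of L-functions for GL_n*, §2.3 (the unramified Godement coefficient).
-/

set_option autoImplicit false
set_option linter.dupNamespace false -- the mandated namespace repeats `HodgeConjecture.HodgeConjecture`

noncomputable section

open Filter Topology Complex NumberField IsDedekindDomain
open Literature.NumberTheory.Automorphic Literature.Analysis.Complex
open Summit.HodgeConjecture.HodgeConjecture.Cruxes.H413.F0P2wPartialDedekindZetaPole

namespace Summit.HodgeConjecture.HodgeConjecture.Cruxes.HLiu418.K2LiuPartialEulerInverseHolomorphy

variable {K : Type} [Field K] [NumberField K] {S : Set (HeightOneSpectrum (𝓞 K))}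

/-! ## §1 The inverse partial zeta as a convergent product of entire factors -/

/-- **`Π_{v∉S} (1 − q_v^{−w}) = ζ_K^S(w)⁻¹`, `1 < re w`** (`HasProd`; ★ `hasProd_partialDedekindZeta` gives the product of the inverses `= ζ_K^S(w) ≠ 0`,
and finite products of inverses are inverses of finite products). [cite: NeukirchANT1999, Ch. VII (5.2)] -/
theorem hasProd_one_sub_residueCard_cpow {w : ℂ} (hw : 1 < w.re) :
    HasProd (fun v : {v : HeightOneSpectrum (𝓞 K) // v ∉ S} => 1 - (v.1.residueCard : ℂ) ^ (-w))
      (partialStandardL S (fun _ => ({1} : Multiset ℂ)) w)⁻¹ := by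
  obtain ⟨h, h0⟩ := hasProd_partialDedekindZeta (S := S) hw
  unfold HasProd at h ⊢
  refine ((h.inv₀ h0).congr fun T => ?_)
  show (∏ v ∈ T, (1 - ((v.1.residueCard : ℂ)) ^ (-w))⁻¹)⁻¹ = ∏ v ∈ T, (1 - ((v.1.residueCard : ℂ)) ^ (-w))
  rw [Finset.prod_inv_distrib, inv_inv]

/-- `ζ_K^S(w)⁻¹ = ∏' (1 − q_v^{−w})` (`tprod` spelling). [cite: NeukirchANT1999, Ch. VII (5.2)] -/
theorem inv_partialDedekindZeta_eq_tprod {w : ℂ} (hw : 1 < w.re) :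
    (partialStandardL S (fun _ => ({1} : Multiset ℂ)) w)⁻¹ = ∏' v : {v : HeightOneSpectrum (𝓞 K) // v ∉ S}, (1 - (v.1.residueCard : ℂ) ^ (-w)) :=
  (hasProd_one_sub_residueCard_cpow hw).tprod_eq.symm

/-! ## §2 The bound `‖ζ_K^S(w)⁻¹‖ ≤ exp (Σ_{v∉S} q_v^{−σ₁})` on `σ₁ ≤ re w` -/

/-- **`‖ζ_K^S(w)⁻¹‖ ≤ exp(Σ_{v∉S} q_v^{−σ₁})`** for `1 < σ₁ ≤ re w`: each factor satisfies `‖(1 − q_v^{−w}) − 1‖ = q_v^{−re w} ≤ q_v^{−σ₁}`, summable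
(★ `summable_residueCard_rpow_neg`), and ★ `norm_tprod_le_exp_tsum`. [cite: Conway1978, VII.5 Lemma 5.8] [cite: NeukirchANT1999, Ch. VII (5.2)] -/
theorem norm_inv_partialDedekindZeta_le_exp {σ₁ : ℝ} (hσ₁ : 1 < σ₁) {w : ℂ} (hw : σ₁ ≤ w.re) :
    ‖(partialStandardL S (fun _ => ({1} : Multiset ℂ)) w)⁻¹‖ ≤
      Real.exp (∑' v : {v : HeightOneSpectrum (𝓞 K) // v ∉ S}, (v.1.residueCard : ℝ) ^ (-σ₁)) := by
  rw [inv_partialDedekindZeta_eq_tprod (lt_of_lt_of_le hσ₁ hw)]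
  refine norm_tprod_le_exp_tsum (U := {w : ℂ | σ₁ ≤ w.re})
    (F := fun (v : {v : HeightOneSpectrum (𝓞 K) // v ∉ S}) (w : ℂ) => 1 - (v.1.residueCard : ℂ) ^ (-w))
    ((summable_residueCard_rpow_neg hσ₁).subtype _) (fun v w' hw' => ?_) hw
  rw [sub_sub_cancel_left, norm_neg]
  exact norm_residueCard_cpow_neg_le _ hw'

/-- **bounded near every point of the open half-plane**: for `1 < re z` there are `C ≥ 0`, `r > 0` with `‖ζ_K^S(w)⁻¹‖ ≤ C` whenever `dist w z < r`
(`r = (re z − 1)/2`, `σ₁ = (re z + 1)/2`). [cite: Conway1978, VII.5 Lemma 5.8] -/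
theorem exists_bound_inv_partialDedekindZeta {z : ℂ} (hz : 1 < z.re) :
    ∃ C r : ℝ, 0 ≤ C ∧ 0 < r ∧ ∀ w : ℂ, dist w z < r → ‖(partialStandardL S (fun _ => ({1} : Multiset ℂ)) w)⁻¹‖ ≤ C := by
  refine ⟨Real.exp (∑' v : {v : HeightOneSpectrum (𝓞 K) // v ∉ S}, (v.1.residueCard : ℝ) ^ (-((z.re + 1) / 2))), (z.re - 1) / 2,
    (Real.exp_pos _).le, by linarith, fun w hwz => norm_inv_partialDedekindZeta_le_exp (by linarith) ?_⟩
  have h1 : |w.re - z.re| ≤ dist w z := by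
    rw [Complex.dist_eq]
    simpa using Complex.abs_re_le_norm (w - z)
  have h2 := (abs_lt.1 (lt_of_le_of_lt h1 hwz)).1
  linarith

/-! ## §3 Holomorphy of `w ↦ ζ_K^S(w)⁻¹` on `{1 < re w}` -/

/-- **`w ↦ ζ_K^S(w)⁻¹` is holomorphic on `{1 < re w}`** (★ `differentiableOn_partialDedekindZeta` and `ζ_K^S(w) ≠ 0` there).
[cite: NeukirchANT1999, Ch. VII (5.2)] -/
theorem differentiableOn_inv_partialDedekindZeta :
    DifferentiableOn ℂ (fun w : ℂ => (partialStandardL S (fun _ => ({1} : Multiset ℂ)) w)⁻¹) {w : ℂ | 1 < w.re} :=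
  differentiableOn_partialDedekindZeta.inv fun _ hw => (hasProd_partialDedekindZeta (S := S) hw).2

/-! ## §4 The pullback `λ ↦ ζ_K^S(2λ + 1)⁻¹` on `{0 < re λ}` — the `had`∕`hag` shape of ★ (γ) `exists_middle_package` -/

/-- `re (2λ + 1) = 2 re λ + 1`. [folklore] -/
theorem re_two_mul_add_one (s : ℂ) : (2 * s + 1).re = 2 * s.re + 1 := by
  simp [Complex.add_re, Complex.mul_re]

/-- **`had`: `λ ↦ ζ_K^S(2λ + 1)⁻¹` is holomorphic on `{0 < re λ}`** (`2λ + 1` maps it into `{1 < re}`). [cite: NeukirchANT1999, Ch. VII (5.2)] -/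
theorem differentiableOn_inv_partialDedekindZeta_two_mul_add_one :
    DifferentiableOn ℂ (fun s : ℂ => (partialStandardL S (fun _ => ({1} : Multiset ℂ)) (2 * s + 1))⁻¹) {s : ℂ | 0 < s.re} :=
  differentiableOn_inv_partialDedekindZeta.comp (((differentiableOn_const _).mul differentiableOn_id).add (differentiableOn_const _))
    fun s hs => by
      have hs' : 0 < s.re := hs
      show 1 < (2 * s + 1).re
      rw [re_two_mul_add_one]; linarith

/-- **`hag`: bounded near every `z` with `0 < re z`**: `‖ζ_K^S(2λ + 1)⁻¹‖ ≤ C` for `dist λ z < re z / 2`, with `C = exp(Σ_{v∉S} q_v^{−(1 + re z)})`.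
[cite: Conway1978, VII.5 Lemma 5.8] [cite: NeukirchANT1999, Ch. VII (5.2)] -/
theorem exists_bound_inv_partialDedekindZeta_two_mul_add_one {z : ℂ} (hz : 0 < z.re) :
    ∃ C r : ℝ, 0 ≤ C ∧ 0 < r ∧ ∀ s : ℂ, dist s z < r → ‖(partialStandardL S (fun _ => ({1} : Multiset ℂ)) (2 * s + 1))⁻¹‖ ≤ C := by
  refine ⟨Real.exp (∑' v : {v : HeightOneSpectrum (𝓞 K) // v ∉ S}, (v.1.residueCard : ℝ) ^ (-(1 + z.re))), z.re / 2,
    (Real.exp_pos _).le, by linarith, fun s hsz => norm_inv_partialDedekindZeta_le_exp (by linarith) ?_⟩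
  have h1 : |s.re - z.re| ≤ dist s z := by
    rw [Complex.dist_eq]
    simpa using Complex.abs_re_le_norm (s - z)
  have h2 := (abs_lt.1 (lt_of_le_of_lt h1 hsz)).1
  rw [re_two_mul_add_one]
  linarith

/-- **packaged for ★ (γ) `exists_middle_package`**: for any constant `c₀ : ℂ` the coefficient `a(λ) := c₀ · ζ_K^S(2λ + 1)⁻¹` satisfies `had` and
`hag` with height-exponent `A = 0` (any `height`, since `height^0 = 1`). [cite: CogdellAnalyticTheory2004, §2.3] [cite: NeukirchANT1999, Ch. VII (5.2)] -/
theorem had_hag_const_mul_inv_partialDedekindZeta {X : Type*} (height : X → ℝ) (c₀ : ℂ) :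
    (∀ _x : X, DifferentiableOn ℂ (fun s : ℂ => c₀ * (partialStandardL S (fun _ => ({1} : Multiset ℂ)) (2 * s + 1))⁻¹) {s : ℂ | 0 < s.re}) ∧
      ∀ z : ℂ, 0 < z.re → ∃ C A r : ℝ, 0 ≤ C ∧ 0 ≤ A ∧ 0 < r ∧ ∀ s : ℂ, dist s z < r →
        ∀ _x : X, ‖c₀ * (partialStandardL S (fun _ => ({1} : Multiset ℂ)) (2 * s + 1))⁻¹‖ ≤ C * height _x ^ A := by
  refine ⟨fun _ => (differentiableOn_const c₀).mul differentiableOn_inv_partialDedekindZeta_two_mul_add_one, fun z hz => ?_⟩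
  obtain ⟨C, r, hC, hr, hb⟩ := exists_bound_inv_partialDedekindZeta_two_mul_add_one (S := S) hz
  refine ⟨‖c₀‖ * C, 0, r, mul_nonneg (norm_nonneg _) hC, le_rfl, hr, fun s hs _ => ?_⟩
  rw [Real.rpow_zero, mul_one, norm_mul]
  exact mul_le_mul_of_nonneg_left (hb s hs) (norm_nonneg _)

end Summit.HodgeConjecture.HodgeConjecture.Cruxes.HLiu418.K2LiuPartialEulerInverseHolomorphy

end
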